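import Literature.Geometry.Lorentzian.KerrConvergence
import Literature.Geometry.Lorentzian.CausalityProofs
import Literature.Geometry.Lorentzian.Isometry
import HarnessLib

/-!
# Blow-up limits of a spacetime at an ideal point; tangent profiles

A **tangent profile** of a time-oriented Lorentzian manifold `(M, g, τ)` at an ideal point is a
blow-up limit of `(M, g)` at that point *modulo scaling and diffeomorphisms*: the Lorentzian
transcription of Hamilton's blow-up limits of Ricci flows / Cheeger–Gromov geometric limits
(Morgan–Tian 2007, Def. 5.3 (geometric limit: exhaustion `V_k`, embeddings `φ_k`,
`φ_k^* g_k → g_∞` uniformly on compact sets in `C^∞`) and Def. 5.32 (blow-up limit: the same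
for the rescaled sequence `Q_k g_k`, `Q_k → ∞`)), with the rescaling written exactly as in the
asymptotically self-similar regime of the Einstein vacuum equations (Rodnianski–
Shlapentokh-Rothman, GAFA 28 (2018), §1: `g_λ := λ⁻² Φ_λ^* g` for the scaling diffeomorphisms
`Φ_λ`, `λ ↓ 0`; Thm. 1.2 "self-similar extraction": `g_{λ_i} → g_sim`), and with the base
*point* of the pointed convergence replaced by an *ideal point* of the causal boundary — a
terminal indecomposable past set `P = I⁻[γ]` (Geroch–Kronheimer–Penrose 1972; in the tree
`LorentzianMetric.IsTIP`, `CauchyDevelopment.FirstNakedPoint`, file `IdealPoints`) — because the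
points at which one blows up (first singularities, vertices of self-similar solutions) are not
points of the manifold. (`IdealPoints` is not imported: the notion here is stated for an
arbitrary marked subset `P`, and the two predicates are simply conjoined by their users, e.g.
`𝒟.FirstNakedPoint P ∧ 𝒟.IsTangentProfileAt P 𝓩 P₀ 2`.)

## Contents (namespace `Literature.Geometry.Lorentzian.Spacetime`)

* `Spacetime.blowupDeviation 𝓢 𝓩 ψ ƛ χ x`: the components, in a local parametrisation
  `χ : V → Z` (`V` open in `ℝᵈ`), of the rescaled deviation `ƛ⁻² (ψ ∘ χ)^* g − χ^* g_Z` of the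
  pulled-back spacetime metric from the profile metric — an honest continuous bilinear form on
  `ℝᵈ`, whose coordinate derivatives are Mathlib's `iteratedFDeriv` (the pattern of
  `Spacetime.deviation` in `KerrConvergence`).
* `Spacetime.BlowupSequence 𝓢 P 𝓩 P₀ k` (hypothesis structure = the data of Morgan–Tian
  Def. 5.3/5.32): scales `ƛₙ > 0`, `ƛₙ → 0`, and maps `ψₙ : Z → M` which near every compact
  subset of `Z` are eventually time-orientation preserving smooth open embeddings, such that
  `ƛₙ⁻² ψₙ^* g → g_Z` in `Cᵏ` on compact subsets of every local parametrisation, and which are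
  **centred at the ideal point**: the pulled-back pasts `ψₙ⁻¹(P)` converge to the marked past
  `P₀ ⊆ Z` of the vertex, locally uniformly off `∂P₀`.
* `Spacetime.IsTangentProfileAt 𝓢 P 𝓩 P₀ k : Prop` — `(Z, g_Z, P₀)` is a `Cᵏ` tangent
  profile (blow-up limit) of `(M, g)` at the ideal point `P` — and its API:
  `BlowupSequence.ofLE` / `IsTangentProfileAt.of_le` (antitone in `k`),
  `BlowupSequence.comp` / `IsTangentProfileAt.comp_strictMono` (subsequences),
  `IsTangentProfileAt.nonempty` (a profile with nonempty vertex past is tangent only to a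
  nonempty past set).
* Sanity (namespace `Literature.Geometry.Lorentzian.Minkowski`): the dilations
  `Minkowski.dilation c = Φ_c : x ↦ c • x` of `ℝ⁴₁` satisfy `Φ_c^* η = c² η`
  (`pullbackBilin_dilation`), preserve `I⁻(0)` (`smul_mem_chronologicalPast_zero_iff`), and the
  rescaled deviation `c⁻² (Φ_c ∘ χ)^* η − χ^* η` vanishes identically
  (`blowupDeviation_dilation`); hence `Minkowski.selfBlowupSequence` (scales `1/(n+1)`) and
  **`Minkowski.isTangentProfileAt_self`: Minkowski spacetime with the marked past `I⁻(0)`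
  (`Minkowski.originPast`) is a `Cᵏ` tangent profile of itself at `I⁻(0)` for every `k`** — the
  structure is inhabited and the scaling convention is the one under which Minkowski space is
  self-similar (Rodnianski–Shlapentokh-Rothman 2018, §1).

## Design choices

* **The limit object is a spacetime with a marked past set.** The vertex of a self-similar
  profile (Rodnianski–Shlapentokh-Rothman 2018, §1: the point `(u, v) = (0, 0)` "blown up" by
  `Φ_λ⁻¹`) is not a point of the profile, and the first singular point of a development is not
  a point of the development; both are ideal points, i.e. TIPs (Geroch–Kronheimer–Penrose 1972;
  Hawking–Ellis 1973, §6.8). In pointed Cheeger–Gromov convergence the embeddings are centred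
  by `φ_k(x_∞) = x_k` (Morgan–Tian Def. 5.3 (2)); for a point `p` of a (distinguishing)
  spacetime the chronological past `I⁻(p)` determines `p`, so the causal transcription of
  "`φ_k` is centred at the base point" is "**the pulled-back pasts converge to the past of the
  vertex**": compact subsets of `P₀` are eventually mapped into `P`, compact subsets of
  `Z ∖ closure P₀` eventually into `M ∖ P` (`eventually_mapsTo`, `eventually_mapsTo_compl`).
  When `∂P₀` is the past null cone of the vertex inside `Z` (a regular vertex past cone), the
  second clause also fixes the centring *in time* (an embedding centred at an earlier point of
  the generator of `P`, at distance `≫ ƛₙ`, pulls `P` back to all of `Z`). The profile is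
  therefore passed as a pair `(𝓩, P₀)`; a bundled self-similar profile supplies
  `P₀ :=` the TIP of its vertex.
* **No exhaustion is chosen.** Instead of Morgan–Tian's increasing precompact exhaustion
  `V_1 ⊆ V_2 ⊆ ⋯` with embeddings `φ_k : V_k → U_k`, the maps `ψₙ` are total functions on `Z`
  required to be, near every compact set, *eventually* smooth time-oriented open embeddings;
  every compact set lies in some `V_k`, and conversely a diagonal argument over a countable
  compact exhaustion of the (second countable) carrier recovers an exhaustion, so nothing is
  lost, and no partial functions or junk values enter the convergence clause (outside the good
  neighbourhoods the pullback `pullbackBilin` is Mathlib's junk `0`, never tested).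
* **`Cᵏ_loc` convergence is tested in every local parametrisation** `χ : V → Z` (smooth open
  embedding of an open `V ⊆ ℝᵈ`), on every compact `C ⊆ V`, by the unweighted `Cᵏ` sup norm
  `supCkENorm` of `KerrConvergence` applied to the extension by zero of the coordinate
  components — for fixed `χ`, `C`, `k` these norms are equivalent to those of any finite atlas,
  so this is ordinary `Cᵏ` convergence on compact sets, stated without choosing an atlas.
* **Scales** are an arbitrary positive null sequence (Rodnianski–Shlapentokh-Rothman take them
  monotonically decreasing; `BlowupSequence.comp` passes to subsequences). `k` is a parameter;
  "`Cᵏ_loc` for some `k ≥ 2`" is `IsTangentProfileAt … 2` by `IsTangentProfileAt.of_le`.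
* Both spacetimes have the same dimension `d` and smooth (`C^∞`) metrics (`Spacetime d`); a
  `Cᵏ_loc` limit of smooth metrics with `k ≥ 2` is the intended use (profiles tangent to smooth
  solutions), rougher "threshold" profiles are deliberately out of scope of this structure.

## What is NOT here

No existence or uniqueness statement: extracting a blow-up limit needs compactness
(curvature/injectivity-radius control in the Riemannian case, Morgan–Tian Thm. 5.6; a
scale-critical a priori estimate in the vacuum case, Rodnianski–Shlapentokh-Rothman 2018,
Thm. 1.2), and uniqueness up to isometry needs the analogue of Morgan–Tian's condition (2b)
or a monotone quantity; these are theorems about the notion, not part of it. Self-similarity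
of the limit is likewise not built in (it is a property of `𝓩`, cf. the definition request
`SelfSimilarVacuumProfile`), nor is any field equation.

## Mathlib / tree

Mathlib has no Cheeger–Gromov convergence, no Lorentzian geometry; we use `TopologicalSpace.Opens`
(open submanifolds of `ℝᵈ` and of the carrier), `ContMDiff(On)`, `Topology.IsOpenEmbedding`,
`mfderiv` (inside `pullbackBilin`, `Isometry`), `iteratedFDeriv` (inside `supCkENorm`,
`KerrConvergence`), `Filter.Tendsto`/`Filter.Eventually` along `atTop`, and for the sanity section
`ContinuousLinearMap.mfderiv_eq`, `Homeomorph.smulOfNeZero`, `Function.extend_zero`. From the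
tree: `Spacetime` (`LorentzianMetric`), `pullbackBilin` (`Isometry`), `supCkENorm`,
`Minkowski.spacetime` (`KerrConvergence`, `KerrSchild`), `TimeOrientation.IsFutureDirected`,
`velocity` (`Geodesic`), `LorentzianMetric.chronologicalPast` (`Causality`),
`IsTimelike.smul` / `IsFutureDirected.smul` (`CausalityProofs`).

## References

* J. Morgan, G. Tian, *Ricci flow and the Poincaré conjecture*, Clay Math. Monographs 3, AMS
  2007, Ch. 5, Def. 5.3 (geometric limits, partial geometric limits), Def. 5.32 (blow-up
  limits), Lemma 5.5 (uniqueness up to isometry).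
* R. S. Hamilton, *The formation of singularities in the Ricci flow*, Surveys in Differential
  Geometry II (1995), §16 (limits of dilations about a singularity).
* I. Rodnianski, Y. Shlapentokh-Rothman, *The asymptotically self-similar regime for the
  Einstein vacuum equations*, GAFA 28 (2018) 755–878, §1 (scaling diffeomorphisms `Φ_λ`,
  `g_λ = λ⁻² Φ_λ^* g`, scaling vector field `K`), Thm. 1.2 (self-similar extraction).
* I. Rodnianski, Y. Shlapentokh-Rothman, *Naked singularities for the Einstein vacuum
  equations: the exterior solution*, Ann. of Math. 198 (2023), §1 (the singularity as the
  vertex of a regular past light cone).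
* R. Geroch, E. H. Kronheimer, R. Penrose, *Ideal points in space-time*, Proc. R. Soc. A 327
  (1972) 545–567 (TIPs `I⁻[γ]`); S. W. Hawking, G. F. R. Ellis 1973, §6.8.
-/

noncomputable section

open TopologicalSpace Manifold Filter Topology Set
open scoped ContDiff Topology ENNReal

universe u v

namespace Literature.Geometry.Lorentzian

namespace Spacetime

variable {d : ℕ}

/-! ### The rescaled deviation in a local parametrisation -/

/-- The **rescaled metric deviation in a local parametrisation.** For spacetimes `𝓢 = (M, g)`
and `𝓩 = (Z, g_Z)` of dimension `d`, a map `ψ : Z → M`, a scale `ƛ` and a local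
parametrisation `χ : V → Z` of `Z` by an open subset `V ⊆ ℝᵈ` (tangent spaces `= ℝᵈ`
definitionally), the continuous bilinear form on `ℝᵈ`
`x ↦ ƛ⁻² ((ψ ∘ χ)^* g)(x) − (χ^* g_Z)(x) = χ^*(ƛ⁻² ψ^* g − g_Z)(x)` (chain rule where `ψ`, `χ`
are differentiable): the coordinate components of the difference between the rescaled
pulled-back metric `g_ƛ = ƛ⁻² ψ^* g` (Rodnianski–Shlapentokh-Rothman, GAFA 28 (2018), §1,
`g_λ = λ⁻² Φ_λ^* g`) and the profile metric, whose `Cᵏ` sup norms on compact sets measure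
`Cᵏ_loc` convergence (Morgan–Tian 2007, Def. 5.3 (2a)). Same pattern as
`Spacetime.deviation` (`KerrConvergence`).
[cite: RodnianskiShlapentokhrothman2018, §1] -/
def blowupDeviation (𝓢 : Spacetime.{u} d) (𝓩 : Spacetime.{v} d) (ψ : 𝓩.carrier → 𝓢.carrier)
    (lam : ℝ) {V : Opens (EuclideanSpace ℝ (Fin d))} (χ : V → 𝓩.carrier) (x : V) :
    EuclideanSpace ℝ (Fin d) →L[ℝ] EuclideanSpace ℝ (Fin d) →L[ℝ] ℝ :=
  (lam ^ 2)⁻¹ •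
      (show EuclideanSpace ℝ (Fin d) →L[ℝ] EuclideanSpace ℝ (Fin d) →L[ℝ] ℝ from
        pullbackBilin (I := 𝓡 d) (I' := 𝓡 d) (ψ ∘ χ) 𝓢.metric.val x) -
    (show EuclideanSpace ℝ (Fin d) →L[ℝ] EuclideanSpace ℝ (Fin d) →L[ℝ] ℝ from
      pullbackBilin (I := 𝓡 d) (I' := 𝓡 d) χ 𝓩.metric.val x)

/-- Unfolding lemma: `blowupDeviation 𝓢 𝓩 ψ ƛ χ x v w = ƛ⁻²·g(d(ψ∘χ) v, d(ψ∘χ) w) −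
g_Z(dχ v, dχ w)` (Rodnianski–Shlapentokh-Rothman 2018, §1; Morgan–Tian 2007, Def. 5.3).
[cite: RodnianskiShlapentokhrothman2018, §1] -/
theorem blowupDeviation_apply (𝓢 : Spacetime.{u} d) (𝓩 : Spacetime.{v} d)
    (ψ : 𝓩.carrier → 𝓢.carrier) (lam : ℝ) {V : Opens (EuclideanSpace ℝ (Fin d))}
    (χ : V → 𝓩.carrier) (x : V) (v w : EuclideanSpace ℝ (Fin d)) :
    blowupDeviation 𝓢 𝓩 ψ lam χ x v w =
      (lam ^ 2)⁻¹ * 𝓢.metric.val (ψ (χ x)) (mfderiv (𝓡 d) (𝓡 d) (ψ ∘ χ) x v)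
          (mfderiv (𝓡 d) (𝓡 d) (ψ ∘ χ) x w) -
        𝓩.metric.val (χ x) (mfderiv (𝓡 d) (𝓡 d) χ x v) (mfderiv (𝓡 d) (𝓡 d) χ x w) :=
  rfl

/-- The `Cᵏ` size, on a compact coordinate patch `C ⊆ V`, of the rescaled deviation: the
`Cᵏ` sup norm (`supCkENorm`, Mathlib's `iteratedFDeriv` of the extension by zero to `ℝᵈ`,
honest on the open set `V`) over `C` of `blowupDeviation`. Its convergence to `0` for every
`(V, χ, C)` is `Cᵏ` convergence on compact sets (Morgan–Tian 2007, Def. 5.3 (2a)).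
[cite: MorganTian2007, Def. 5.3] -/
def blowupDeviationCk (𝓢 : Spacetime.{u} d) (𝓩 : Spacetime.{v} d)
    (ψ : 𝓩.carrier → 𝓢.carrier) (lam : ℝ) {V : Opens (EuclideanSpace ℝ (Fin d))}
    (χ : V → 𝓩.carrier) (C : Set V) (k : ℕ) : ℝ≥0∞ :=
  supCkENorm (Subtype.val '' C) k
    (Function.extend Subtype.val (blowupDeviation 𝓢 𝓩 ψ lam χ) 0)

/-- `blowupDeviationCk` is monotone in the number of derivatives `k` (Bartnik-type `Cᵏ` sup
norms are nested; `supCkENorm_mono_right`). [cite: MorganTian2007, Def. 5.3] -/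
theorem blowupDeviationCk_mono (𝓢 : Spacetime.{u} d) (𝓩 : Spacetime.{v} d)
    (ψ : 𝓩.carrier → 𝓢.carrier) (lam : ℝ) {V : Opens (EuclideanSpace ℝ (Fin d))}
    (χ : V → 𝓩.carrier) (C : Set V) {k k' : ℕ} (h : k ≤ k') :
    blowupDeviationCk 𝓢 𝓩 ψ lam χ C k ≤ blowupDeviationCk 𝓢 𝓩 ψ lam χ C k' :=
  supCkENorm_mono_right _ h _

/-! ### Blow-up sequences and tangent profiles -/

/-- A **blow-up sequence exhibiting `(𝓩, P₀)` as a `Cᵏ` blow-up limit of `𝓢` at the ideal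
point `P`** — the data of a (partial) geometric limit of the rescaled spacetimes
`(M, ƛₙ⁻² g)` in the sense of Morgan–Tian 2007, Def. 5.3 / Def. 5.32, transcribed to
time-oriented Lorentzian manifolds with an ideal base point. Here `𝓢 = (M, g, τ)` is a spacetime
(typically a Cauchy development), `P ⊆ M` a past set representing an ideal point of the causal
boundary (a TIP `I⁻[γ]`, Geroch–Kronheimer–Penrose 1972, `LorentzianMetric.IsTIP`; e.g. a first
naked point, `CauchyDevelopment.FirstNakedPoint` of `IdealPoints`),
`𝓩 = (Z, g_Z, τ_Z)` the candidate profile (e.g. a self-similar vacuum spacetime *without* its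
vertex) and `P₀ ⊆ Z` the chronological past, inside `Z`, of the vertex of `𝓩`. The data:
* `scale = (ƛₙ)`, positive with `ƛₙ → 0` (Rodnianski–Shlapentokh-Rothman 2018, §1 and
  Thm. 1.2: `λ_i ↓ 0`);
* `embed = (ψₙ : Z → M)`: near every compact `C ⊆ Z`, eventually a smooth open embedding of a
  neighbourhood `U ⊇ C` whose differential maps the time orientation of `Z` to future-directed
  vectors of `M` (Morgan–Tian Def. 5.3 (1), (2): embeddings of an exhaustion);
* `tendsto_blowupDeviationCk`: `ƛₙ⁻² ψₙ^* g → g_Z` in `Cᵏ` on every compact subset of every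
  local parametrisation `χ : V → Z` (Morgan–Tian Def. 5.3 (2a) with `Cᵏ` in place of `C^∞`;
  Rodnianski–Shlapentokh-Rothman's `g_{λ_i} → g_sim`);
* `eventually_mapsTo`, `eventually_mapsTo_compl` (**centring at the ideal point**, replacing
  `φ_k(x_∞) = x_k` of Morgan–Tian Def. 5.3 (2)): compact subsets of `P₀` are eventually mapped
  into `P`, compact subsets of `Z ∖ closure P₀` eventually into `M ∖ P` — the pulled-back pasts
  `ψₙ⁻¹(P)` converge to `P₀` locally uniformly off `∂P₀`.
[cite: MorganTian2007, Def. 5.3 and Def. 5.32] -/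
structure BlowupSequence (𝓢 : Spacetime.{u} d) (P : Set 𝓢.carrier) (𝓩 : Spacetime.{v} d)
    (P₀ : Set 𝓩.carrier) (k : ℕ) where
  /-- The scales `ƛₙ`. -/
  scale : ℕ → ℝ
  /-- The comparison maps `ψₙ : Z → M` (embeddings near every compact set, eventually). -/
  embed : ℕ → 𝓩.carrier → 𝓢.carrier
  /-- The scales are positive. -/
  scale_pos : ∀ n, 0 < scale n
  /-- The scales tend to zero (one zooms in). -/
  tendsto_scale : Tendsto scale atTop (𝓝 0)
  /-- Near every compact `C ⊆ Z`, eventually `ψₙ` is a smooth open embedding of an open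
  neighbourhood `U ⊇ C` mapping the time orientation of `Z` to future-directed vectors. -/
  eventually_isOpenEmbedding : ∀ C : Set 𝓩.carrier, IsCompact C → ∀ᶠ n in atTop,
    ∃ U : Opens 𝓩.carrier, C ⊆ U ∧ ContMDiffOn (𝓡 d) (𝓡 d) ∞ (embed n) U ∧
      IsOpenEmbedding ((U : Set 𝓩.carrier).restrict (embed n)) ∧
      ∀ z ∈ U, 𝓢.timeOrientation.IsFutureDirected
        (mfderiv (𝓡 d) (𝓡 d) (embed n) z (𝓩.timeOrientation.vectorField z))
  /-- `ƛₙ⁻² ψₙ^* g → g_Z` in `Cᵏ` on every compact subset of every local parametrisation. -/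
  tendsto_blowupDeviationCk : ∀ (V : Opens (EuclideanSpace ℝ (Fin d))) (χ : V → 𝓩.carrier),
    ContMDiff (𝓡 d) (𝓡 d) ∞ χ → IsOpenEmbedding χ → ∀ C : Set V, IsCompact C →
      Tendsto (fun n ↦ blowupDeviationCk 𝓢 𝓩 (embed n) (scale n) χ C k) atTop (𝓝 0)
  /-- Centring, inner half: compact subsets of the vertex past `P₀` are eventually mapped into
  the ideal point's past `P`. -/
  eventually_mapsTo : ∀ C : Set 𝓩.carrier, IsCompact C → C ⊆ P₀ →
    ∀ᶠ n in atTop, MapsTo (embed n) C P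
  /-- Centring, outer half: compact subsets of `Z ∖ closure P₀` are eventually mapped into
  `M ∖ P`. -/
  eventually_mapsTo_compl : ∀ C : Set 𝓩.carrier, IsCompact C → C ⊆ (closure P₀)ᶜ →
    ∀ᶠ n in atTop, MapsTo (embed n) C Pᶜ

/-- **`(𝓩, P₀)` is a `Cᵏ` tangent profile of the spacetime `𝓢` at the ideal point `P`**
(a blow-up limit modulo scaling and diffeomorphisms, centred at `P`): there is a blow-up
sequence — scales `ƛₙ ↓ 0` and eventual time-oriented smooth open embeddings `ψₙ` of
neighbourhoods of the compact subsets of `Z` into `M`, centred at `P` (`ψₙ⁻¹(P) → P₀`), with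
`ƛₙ⁻² ψₙ^* g → g_Z` in `Cᵏ_loc` (`BlowupSequence`). Lorentzian transcription of blow-up /
geometric limits (Morgan–Tian 2007, Def. 5.3, Def. 5.32; Hamilton 1995, §16) in the scaling
conventions of Rodnianski–Shlapentokh-Rothman (GAFA 28 (2018), §1, Thm. 1.2), the base point
being an ideal point = TIP (Geroch–Kronheimer–Penrose 1972; `LorentzianMetric.IsTIP` of
`IdealPoints`). Intended instances: `𝓢` the spacetime of a (maximal) Cauchy development `𝒟`
(dot notation `𝒟.IsTangentProfileAt P 𝓩 P₀ k` resolves through `CauchyDevelopment → DataEmbedding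
→ Spacetime`), `P : Set 𝒟.carrier` a first naked point (`𝒟.FirstNakedPoint P`,
`CauchyDevelopment.FirstNakedPoint` of `IdealPoints`), `𝓩` a self-similar vacuum profile without
its vertex and `P₀` the chronological past of the vertex in `𝓩`; "in `Cᵏ_loc` for some `k ≥ 2`"
is the case `k = 2` (`IsTangentProfileAt.of_le`, `IsTangentProfileAt.exists_ge_iff`).
[cite: MorganTian2007, Def. 5.3 and Def. 5.32] -/
def IsTangentProfileAt (𝓢 : Spacetime.{u} d) (P : Set 𝓢.carrier) (𝓩 : Spacetime.{v} d)
    (P₀ : Set 𝓩.carrier) (k : ℕ) : Prop :=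
  Nonempty (BlowupSequence 𝓢 P 𝓩 P₀ k)

/-- Unfolding lemma for `IsTangentProfileAt`. [cite: MorganTian2007, Def. 5.3 and Def. 5.32] -/
theorem isTangentProfileAt_iff (𝓢 : Spacetime.{u} d) (P : Set 𝓢.carrier)
    (𝓩 : Spacetime.{v} d) (P₀ : Set 𝓩.carrier) (k : ℕ) :
    IsTangentProfileAt 𝓢 P 𝓩 P₀ k ↔ Nonempty (BlowupSequence 𝓢 P 𝓩 P₀ k) :=
  Iff.rfl

namespace BlowupSequence

variable {𝓢 : Spacetime.{u} d} {P : Set 𝓢.carrier} {𝓩 : Spacetime.{v} d}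
  {P₀ : Set 𝓩.carrier} {k k' : ℕ}

/-- The scales of a blow-up sequence are nonzero. [cite: RodnianskiShlapentokhrothman2018, §1] -/
theorem scale_ne_zero (B : BlowupSequence 𝓢 P 𝓩 P₀ k) (n : ℕ) : B.scale n ≠ 0 :=
  (B.scale_pos n).ne'

/-- A `Cᵏ'` blow-up sequence is a `Cᵏ` blow-up sequence for `k ≤ k'` (same data; the `Cᵏ` sup
norms are dominated by the `Cᵏ'` ones). Morgan–Tian 2007, Def. 5.3 (2a).
[cite: MorganTian2007, Def. 5.3] -/
def ofLE (h : k ≤ k') (B : BlowupSequence 𝓢 P 𝓩 P₀ k') : BlowupSequence 𝓢 P 𝓩 P₀ k where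
  scale := B.scale
  embed := B.embed
  scale_pos := B.scale_pos
  tendsto_scale := B.tendsto_scale
  eventually_isOpenEmbedding := B.eventually_isOpenEmbedding
  tendsto_blowupDeviationCk V χ hχ hχ' C hC :=
    tendsto_of_tendsto_of_tendsto_of_le_of_le tendsto_const_nhds
      (B.tendsto_blowupDeviationCk V χ hχ hχ' C hC) (fun _ ↦ zero_le)
      fun n ↦ blowupDeviationCk_mono 𝓢 𝓩 (B.embed n) (B.scale n) χ C h
  eventually_mapsTo := B.eventually_mapsTo
  eventually_mapsTo_compl := B.eventually_mapsTo_compl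

/-- The scales of `B.ofLE h` are those of `B`. [cite: MorganTian2007, Def. 5.3] -/
@[simp]
theorem scale_ofLE (h : k ≤ k') (B : BlowupSequence 𝓢 P 𝓩 P₀ k') :
    (B.ofLE h).scale = B.scale :=
  rfl

/-- The maps of `B.ofLE h` are those of `B`. [cite: MorganTian2007, Def. 5.3] -/
@[simp]
theorem embed_ofLE (h : k ≤ k') (B : BlowupSequence 𝓢 P 𝓩 P₀ k') :
    (B.ofLE h).embed = B.embed :=
  rfl

/-- **Subsequences** of a blow-up sequence are blow-up sequences (with the same limit):
precomposition with a strictly monotone `φ : ℕ → ℕ`. Rodnianski–Shlapentokh-Rothman 2018,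
Thm. 1.2 (any `λ_i ↓ 0`); Morgan–Tian 2007, Def. 5.3. [cite: MorganTian2007, Def. 5.3] -/
def comp (B : BlowupSequence 𝓢 P 𝓩 P₀ k) {φ : ℕ → ℕ} (hφ : StrictMono φ) :
    BlowupSequence 𝓢 P 𝓩 P₀ k where
  scale := B.scale ∘ φ
  embed := B.embed ∘ φ
  scale_pos n := B.scale_pos (φ n)
  tendsto_scale := B.tendsto_scale.comp hφ.tendsto_atTop
  eventually_isOpenEmbedding C hC :=
    hφ.tendsto_atTop.eventually (B.eventually_isOpenEmbedding C hC)
  tendsto_blowupDeviationCk V χ hχ hχ' C hC :=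
    (B.tendsto_blowupDeviationCk V χ hχ hχ' C hC).comp hφ.tendsto_atTop
  eventually_mapsTo C hC hCP := hφ.tendsto_atTop.eventually (B.eventually_mapsTo C hC hCP)
  eventually_mapsTo_compl C hC hCP :=
    hφ.tendsto_atTop.eventually (B.eventually_mapsTo_compl C hC hCP)

/-- The scales of the subsequence `B.comp hφ` are `ƛ_{φ n}`. [cite: MorganTian2007, Def. 5.3] -/
@[simp]
theorem scale_comp (B : BlowupSequence 𝓢 P 𝓩 P₀ k) {φ : ℕ → ℕ} (hφ : StrictMono φ) (n : ℕ) :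
    (B.comp hφ).scale n = B.scale (φ n) :=
  rfl

/-- The maps of the subsequence `B.comp hφ` are `ψ_{φ n}`. [cite: MorganTian2007, Def. 5.3] -/
@[simp]
theorem embed_comp (B : BlowupSequence 𝓢 P 𝓩 P₀ k) {φ : ℕ → ℕ} (hφ : StrictMono φ) (n : ℕ) :
    (B.comp hφ).embed n = B.embed (φ n) :=
  rfl

/-- Centring has content: a point of the vertex past `P₀` is eventually mapped into `P`.
Morgan–Tian 2007, Def. 5.3 (2) (`φ_k(x_∞) = x_k`). [cite: MorganTian2007, Def. 5.3] -/
theorem eventually_mem (B : BlowupSequence 𝓢 P 𝓩 P₀ k) {z : 𝓩.carrier} (hz : z ∈ P₀) :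
    ∀ᶠ n in atTop, B.embed n z ∈ P :=
  (B.eventually_mapsTo {z} isCompact_singleton (singleton_subset_iff.mpr hz)).mono
    fun _ h ↦ h (mem_singleton z)

/-- Dually, a point outside `closure P₀` is eventually mapped outside `P`.
Morgan–Tian 2007, Def. 5.3 (2). [cite: MorganTian2007, Def. 5.3] -/
theorem eventually_not_mem (B : BlowupSequence 𝓢 P 𝓩 P₀ k) {z : 𝓩.carrier}
    (hz : z ∉ closure P₀) : ∀ᶠ n in atTop, B.embed n z ∉ P :=
  (B.eventually_mapsTo_compl {z} isCompact_singleton (singleton_subset_iff.mpr hz)).mono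
    fun _ h ↦ h (mem_singleton z)

end BlowupSequence

namespace IsTangentProfileAt

variable {𝓢 : Spacetime.{u} d} {P : Set 𝓢.carrier} {𝓩 : Spacetime.{v} d}
  {P₀ : Set 𝓩.carrier} {k k' : ℕ}

/-- A `Cᵏ'` tangent profile is a `Cᵏ` tangent profile for `k ≤ k'`; in particular "tangent in
`Cᵏ_loc` for some `k ≥ 2`" is equivalent to "tangent in `C²_loc`". Morgan–Tian 2007,
Def. 5.3 (2a). [cite: MorganTian2007, Def. 5.3] -/
theorem of_le (h : IsTangentProfileAt 𝓢 P 𝓩 P₀ k') (hk : k ≤ k') :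
    IsTangentProfileAt 𝓢 P 𝓩 P₀ k :=
  h.map (BlowupSequence.ofLE hk)

/-- "Tangent in `Cᵏ_loc` for some `k ≥ k₀`" is "tangent in `C^{k₀}_loc`".
Morgan–Tian 2007, Def. 5.3 (2a). [cite: MorganTian2007, Def. 5.3] -/
theorem exists_ge_iff (k₀ : ℕ) :
    (∃ k, k₀ ≤ k ∧ IsTangentProfileAt 𝓢 P 𝓩 P₀ k) ↔ IsTangentProfileAt 𝓢 P 𝓩 P₀ k₀ :=
  ⟨fun ⟨_, hk, h⟩ ↦ h.of_le hk, fun h ↦ ⟨k₀, le_rfl, h⟩⟩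

/-- Tangent profiles are seen along any subsequence of scales. Rodnianski–Shlapentokh-Rothman
2018, Thm. 1.2; Morgan–Tian 2007, Def. 5.3. [cite: MorganTian2007, Def. 5.3] -/
theorem comp_strictMono (h : IsTangentProfileAt 𝓢 P 𝓩 P₀ k) {φ : ℕ → ℕ} (hφ : StrictMono φ) :
    ∃ B : BlowupSequence 𝓢 P 𝓩 P₀ k, ∃ B₀ : BlowupSequence 𝓢 P 𝓩 P₀ k,
      B.scale = B₀.scale ∘ φ ∧ B.embed = B₀.embed ∘ φ :=
  let ⟨B₀⟩ := h
  ⟨B₀.comp hφ, B₀, rfl, rfl⟩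

/-- A profile whose vertex past `P₀` is nonempty can only be tangent at a **nonempty** past set
`P` (centring is not vacuous). Morgan–Tian 2007, Def. 5.3 (2). [cite: MorganTian2007, Def. 5.3] -/
theorem nonempty (h : IsTangentProfileAt 𝓢 P 𝓩 P₀ k) (h₀ : P₀.Nonempty) : P.Nonempty := by
  obtain ⟨B⟩ := h
  obtain ⟨z, hz⟩ := h₀
  obtain ⟨n, hn⟩ := (B.eventually_mem hz).exists
  exact ⟨B.embed n z, hn⟩

/-- Dually, if some point of `Z` lies outside `closure P₀`, then `P` is not all of `M`
(its complement is nonempty). Morgan–Tian 2007, Def. 5.3 (2). [cite: MorganTian2007, Def. 5.3] -/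
theorem compl_nonempty (h : IsTangentProfileAt 𝓢 P 𝓩 P₀ k) (h₀ : (closure P₀)ᶜ.Nonempty) :
    Pᶜ.Nonempty := by
  obtain ⟨B⟩ := h
  obtain ⟨z, hz⟩ := h₀
  obtain ⟨n, hn⟩ := (B.eventually_not_mem hz).exists
  exact ⟨B.embed n z, hn⟩

end IsTangentProfileAt

end Spacetime

/-! ### Sanity: Minkowski space is its own tangent profile at the origin

Non-vacuity of `BlowupSequence` / `IsTangentProfileAt` and a check of the scaling convention:
for the dilations `Φ_c x = c • x` of `ℝ⁴₁` one has `Φ_c^* η = c² η`, so `c⁻² Φ_c^* η = η` exactly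
(Rodnianski–Shlapentokh-Rothman 2018, §1: "Minkowski space ... yields a self-similar solution"),
the dilations are time-orientation preserving global diffeomorphisms for `c > 0`, and they preserve
the chronological past `I⁻(0)` of the origin (the TIP of the vertex `0`). Hence, with scales
`ƛₙ = 1/(n+1)` and `ψₙ = Φ_{ƛₙ}`, Minkowski spacetime with the marked past `I⁻(0)` is a `Cᵏ`
tangent profile of itself at the ideal point `I⁻(0)`, for every `k`. -/

namespace Minkowski

/-- The **dilation** `Φ_c : x ↦ c • x` of `E4` about the origin, as a continuous linear map —
the scaling diffeomorphisms of Rodnianski–Shlapentokh-Rothman 2018, §1, in Cartesian instead of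
double-null coordinates (`(u, v, θ) ↦ (λu, λv, θ)` is `x ↦ λx`).
[cite: RodnianskiShlapentokhrothman2018, §1] -/
def dilation (c : ℝ) : E4 →L[ℝ] E4 :=
  c • ContinuousLinearMap.id ℝ E4

/-- `Φ_c x = c • x`. [cite: RodnianskiShlapentokhrothman2018, §1] -/
@[simp]
theorem dilation_apply (c : ℝ) (x : E4) : dilation c x = c • x :=
  rfl

/-- `η(c v, c w) = c² η(v, w)` (bilinearity; O'Neill 1983, Ch. 3, p. 55). [folklore] -/
theorem bilin_smul_smul (c : ℝ) (v w : E4) : bilin (c • v) (c • w) = c ^ 2 * bilin v w := by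
  simp only [map_smul, FunLike.coe_smul, Pi.smul_apply, smul_eq_mul]
  ring

/-- A nonzero dilation is an open embedding (indeed a homeomorphism, Mathlib
`Homeomorph.smulOfNeZero`). [folklore] -/
theorem isOpenEmbedding_dilation {c : ℝ} (hc : c ≠ 0) : IsOpenEmbedding (dilation c) :=
  (Homeomorph.smulOfNeZero c hc).isOpenEmbedding

/-- Dilations are differentiable, as maps of the carrier of `Minkowski.spacetime` (which is `E4`
by unfolding the definition). [folklore] -/
theorem mdifferentiableAt_dilation (c : ℝ) (x : E4) :
    MDifferentiableAt (𝓡 4) (𝓡 4) (M := spacetime.carrier) (M' := spacetime.carrier)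
      (dilation c) x :=
  (dilation c).mdifferentiableAt

/-- The differential of the dilation `Φ_c` is `Φ_c` (a linear map is its own derivative,
Mathlib `ContinuousLinearMap.mfderiv_eq`). [folklore] -/
theorem mfderiv_dilation (c : ℝ) (x : E4) :
    mfderiv (𝓡 4) (𝓡 4) (M := spacetime.carrier) (M' := spacetime.carrier) (dilation c) x =
      dilation c :=
  ContinuousLinearMap.mfderiv_eq (dilation c)

/-- **`Φ_c^* η = c² η`**: Minkowski space is exactly self-similar under the dilations
(Rodnianski–Shlapentokh-Rothman 2018, §1: `g_λ = λ⁻² Φ_λ^* g = g` for Minkowski space).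
[cite: RodnianskiShlapentokhrothman2018, §1] -/
theorem pullbackBilin_dilation (c : ℝ) (x : E4) (v w : E4) :
    pullbackBilin (I := 𝓡 4) (I' := 𝓡 4) (M := spacetime.carrier) (N := spacetime.carrier)
      (dilation c) spacetime.metric.val x v w = c ^ 2 * bilin v w := by
  rw [pullbackBilin_apply, mfderiv_dilation]
  exact bilin_smul_smul c v w

/-- Chain rule: the velocity of the dilated curve `Φ_c ∘ γ` is `c γ'` (stated over the carrier of
`Minkowski.spacetime`, proved over `E4`). [folklore] -/
theorem velocity_dilation_comp (c : ℝ) {γ : ℝ → E4} {t : ℝ}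
    (hγ : MDifferentiableAt 𝓘(ℝ, ℝ) 𝓘(ℝ, E4) γ t) :
    velocity (𝓡 4) (M := spacetime.carrier) (dilation c ∘ γ) t =
      c • velocity (𝓡 4) (M := spacetime.carrier) γ t := by
  show velocity 𝓘(ℝ, E4) (M := E4) (dilation c ∘ γ) t = c • velocity 𝓘(ℝ, E4) (M := E4) γ t
  unfold velocity
  rw [mfderiv_comp t (dilation c).mdifferentiableAt hγ, ContinuousLinearMap.mfderiv_eq]
  rfl

/-- Dilations by `c > 0` map past-directed timelike curves (future-directed for the reversed
orientation `−∂ₜ`) to past-directed timelike curves: `η(cγ', cγ') = c² η(γ', γ') < 0` and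
`η(−∂ₜ, cγ') = c η(−∂ₜ, γ') < 0` (O'Neill 1983, Ch. 5, Lemma 5.29 ff.: timecones are cones).
[folklore] -/
theorem isFutureTimelikeCurveOn_reverse_dilation_comp {c : ℝ} (hc : 0 < c)
    {γ : ℝ → E4} {s : Set ℝ}
    (h : spacetime.metric.IsFutureTimelikeCurveOn spacetime.timeOrientation.reverse γ s) :
    spacetime.metric.IsFutureTimelikeCurveOn spacetime.timeOrientation.reverse
      (dilation c ∘ γ) s := by
  intro t ht
  obtain ⟨hd, htl, hfd⟩ := h t ht
  refine ⟨(dilation c).mdifferentiableAt.comp t hd, ?_, ?_⟩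
  · rw [velocity_dilation_comp c hd]
    exact htl.smul hc.ne'
  · rw [velocity_dilation_comp c hd]
    exact hfd.smul hc

/-- **Dilations by `c > 0` preserve the chronological past `I⁻(0)` of the origin** (the image of
a past-directed timelike curve from `0` to `q` is one from `0` to `c q`). O'Neill 1983, Ch. 5,
Ex. 5.1 (timecones of `ℝ⁴₁`). [folklore] -/
theorem smul_mem_chronologicalPast_zero {c : ℝ} (hc : 0 < c) {q : E4}
    (hq : q ∈ spacetime.metric.chronologicalPast spacetime.timeOrientation ({0} : Set E4)) :
    c • q ∈ spacetime.metric.chronologicalPast spacetime.timeOrientation ({0} : Set E4) := by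
  obtain ⟨p, hp, γ, a, b, hab, hγ, hγa, hγb⟩ := hq
  have hp0 : p = (0 : E4) := hp
  refine ⟨(0 : E4), rfl, dilation c ∘ γ, a, b, hab,
    isFutureTimelikeCurveOn_reverse_dilation_comp hc hγ, ?_, ?_⟩
  · calc (dilation c ∘ γ) a = dilation c (γ a) := rfl
      _ = dilation c p := by rw [hγa]
      _ = (0 : E4) := by rw [hp0, map_zero]
  · calc (dilation c ∘ γ) b = dilation c (γ b) := rfl
      _ = dilation c q := by rw [hγb]
      _ = c • q := rfl

/-- `c • q ∈ I⁻(0) ↔ q ∈ I⁻(0)` for `c > 0` (apply the previous lemma to `c` and `c⁻¹`).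
O'Neill 1983, Ch. 5, Ex. 5.1. [folklore] -/
theorem smul_mem_chronologicalPast_zero_iff {c : ℝ} (hc : 0 < c) (q : E4) :
    c • q ∈ spacetime.metric.chronologicalPast spacetime.timeOrientation ({0} : Set E4) ↔
      q ∈ spacetime.metric.chronologicalPast spacetime.timeOrientation ({0} : Set E4) := by
  refine ⟨fun h ↦ ?_, smul_mem_chronologicalPast_zero hc⟩
  have := smul_mem_chronologicalPast_zero (inv_pos.mpr hc) h
  rwa [inv_smul_smul₀ hc.ne'] at this

/-- **The rescaled deviation of Minkowski space from itself under a dilation vanishes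
identically**: in every local parametrisation `χ`, `c⁻² (Φ_c ∘ χ)^* η − χ^* η = 0`, by the chain
rule and `Φ_c^* η = c² η` (Rodnianski–Shlapentokh-Rothman 2018, §1: `g_λ = g` for Minkowski
space). [cite: RodnianskiShlapentokhrothman2018, §1] -/
theorem blowupDeviation_dilation {c : ℝ} (hc : c ≠ 0) {V : Opens (EuclideanSpace ℝ (Fin 4))}
    {χ : V → E4} (hχ : MDifferentiable (𝓡 4) (𝓡 4) (M' := spacetime.carrier) χ) (x : V) :
    Spacetime.blowupDeviation spacetime spacetime (dilation c) c χ x = 0 := by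
  ext v w
  rw [Spacetime.blowupDeviation_apply, mfderiv_comp x (mdifferentiableAt_dilation c (χ x)) (hχ x),
    mfderiv_dilation]
  show (c ^ 2)⁻¹ * bilin (dilation c (mfderiv (𝓡 4) (𝓡 4) χ x v))
      (dilation c (mfderiv (𝓡 4) (𝓡 4) χ x w)) -
        bilin (mfderiv (𝓡 4) (𝓡 4) χ x v) (mfderiv (𝓡 4) (𝓡 4) χ x w) = 0
  rw [dilation_apply, dilation_apply, bilin_smul_smul, ← mul_assoc, inv_mul_cancel₀ (pow_ne_zero 2 hc),
    one_mul, sub_self]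

/-- The chronological past `I⁻(0)` of the origin of Minkowski spacetime — the TIP representing the
(here regular) vertex `0` of the self-similar solution `(ℝ⁴₁, η, x·∂ₓ)`. O'Neill 1983, Ch. 14,
pp. 402–403; Hawking–Ellis 1973, §6.8 and Geroch–Kronheimer–Penrose 1972 (`I⁻(p)` is the TIP of
a point `p` of the spacetime). [cite: HawkingEllis1973, §6.8] -/
def originPast : Set spacetime.carrier :=
  spacetime.metric.chronologicalPast spacetime.timeOrientation ({0} : Set E4)

/-- **Minkowski space blows up to itself at the origin**: the blow-up sequence with scales
`ƛₙ = 1/(n+1)` and maps `ψₙ = Φ_{ƛₙ}` (dilations), for which `ƛₙ⁻² ψₙ^* η = η` exactly, the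
`ψₙ` are time-orientation preserving global diffeomorphisms, and `ψₙ(I⁻(0)) = I⁻(0)`.
Rodnianski–Shlapentokh-Rothman 2018, §1 (Minkowski space is self-similar: `g_λ = g`);
Morgan–Tian 2007, Def. 5.3 (constant sequences converge). [cite: RodnianskiShlapentokhrothman2018, §1] -/
def selfBlowupSequence (k : ℕ) :
    Spacetime.BlowupSequence spacetime originPast spacetime originPast k where
  scale n := 1 / ((n : ℝ) + 1)
  embed n := dilation (1 / ((n : ℝ) + 1))
  scale_pos n := Nat.one_div_pos_of_nat
  tendsto_scale := tendsto_one_div_add_atTop_nhds_zero_nat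
  eventually_isOpenEmbedding C hC := Eventually.of_forall fun n ↦ by
    refine ⟨⊤, fun _ _ ↦ trivial, (dilation _).contMDiff.contMDiffOn, ?_, fun z _ ↦ ?_⟩
    · exact (isOpenEmbedding_dilation Nat.one_div_pos_of_nat.ne').comp
        (⊤ : Opens spacetime.carrier).isOpen.isOpenEmbedding_subtypeVal
    · rw [mfderiv_dilation]
      exact (spacetime.timeOrientation.isFutureDirected_vectorField z).smul Nat.one_div_pos_of_nat
  tendsto_blowupDeviationCk V χ hχ hχ' C hC := by
    have h0 : ∀ n : ℕ, Spacetime.blowupDeviationCk spacetime spacetime (dilation (1 / ((n : ℝ) + 1)))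
        (1 / ((n : ℝ) + 1)) χ C k = 0 := fun n ↦ by
      unfold Spacetime.blowupDeviationCk
      have hdev : Spacetime.blowupDeviation spacetime spacetime (dilation (1 / ((n : ℝ) + 1)))
          (1 / ((n : ℝ) + 1)) χ = 0 :=
        funext fun x ↦ blowupDeviation_dilation Nat.one_div_pos_of_nat.ne'
          (hχ.mdifferentiable (by simp)) x
      rw [hdev, Function.extend_zero]
      exact supCkENorm_zero _ _
    simp only [h0]
    exact tendsto_const_nhds
  eventually_mapsTo C hC hCP := Eventually.of_forall fun n x hx ↦
    smul_mem_chronologicalPast_zero Nat.one_div_pos_of_nat (hCP hx)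
  eventually_mapsTo_compl C hC hCP := Eventually.of_forall fun n x hx hmem ↦
    hCP hx (subset_closure ((smul_mem_chronologicalPast_zero_iff Nat.one_div_pos_of_nat x).mp hmem))

/-- **Minkowski spacetime, with the marked past `I⁻(0)`, is a `Cᵏ` tangent profile of itself at
the ideal point `I⁻(0)`, for every `k`** (`selfBlowupSequence`): the notion `IsTangentProfileAt`
is inhabited, with the scaling convention of Rodnianski–Shlapentokh-Rothman 2018, §1 (Minkowski
space in the role of the trivial self-similar solution). [cite: RodnianskiShlapentokhrothman2018, §1] -/
theorem isTangentProfileAt_self (k : ℕ) :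
    Spacetime.IsTangentProfileAt spacetime originPast spacetime originPast k :=
  ⟨selfBlowupSequence k⟩

end Minkowski

end Literature.Geometry.Lorentzian

end
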